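import Summits.ValiantsHypothesis.ValiantsHypothesis.Theorems.LacunarySymmetroidMatrixDescartesDoorA26WallBubblingTripleZeroDeriv

/-!
# `DoorA26` / line `wall_bubbling` — LOCAL SIGNS of a real exponential sum at a simple and at a double zero

HONEST FRAMING.  Object-search cell `pub-symmetroid`, crux `Theses.LacunarySymmetroid.DoorA26` (stmt-ValiantsHypothesis-19979; OPEN, typed,
never asserted).  W2 seat val-sym-door-p1 g19, file #56; def-free calculus helper for obligation (R) of `Cruxes/DoorA26/Lines/wall_bubbling.lean`,
used by #57 `…WallBubblingHonestEncoding` (every rank-one double-zero profile sits on 21 alternating abscissae).  Imports #50 `…TripleZeroDeriv` for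
the exponential-sum calculus (`Bubbling.expSum`, `Bubbling.hasDerivAt_expSum`, `iteratedDeriv_expSum`) and `Census.RealExp.exists_zero_of_mul_neg`.

WHAT IS HERE.  `continuous_expSum`, `deriv_expSum_eq` (`deriv (expSum a x) = expSum (a·x) x`), ★ `expSum_sign_near_simple` (`f(z) = 0 ≠ f′(z)` ⇒
`f′(z)·f > 0` just right of `z` and `< 0` just left: `f′` keeps its sign on a neighbourhood, so `f′(z)·f` is strictly increasing there —
`strictMonoOn_of_deriv_pos`), ★ `expSum_sign_near_double` (`f(z) = f′(z) = 0 ≠ f″(z)` ⇒ `f″(z)·f > 0` on a punctured neighbourhood: the simple-zero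
lemma for `f′`, then `f″(z)·f` is strictly decreasing left of `z` and increasing right of it), `mul_pos_of_no_zero` (a continuous function with no
zero on `[s,t]` has `f(s)·f(t) > 0`, intermediate value theorem).  Nothing here bears on `DoorA26`, `DoorA34`, (W)/(M)/(R), `MatrixDescartes` (18050)
or `VP ≠ VNP`; registers unchanged.

[folklore] first and second derivative tests; intermediate value theorem.  [this work] the packaging for exponential sums.
-/

set_option linter.dupNamespace false

namespace Summit.ValiantsHypothesis.ValiantsHypothesis.Theorems.LacunarySymmetroidMatrixDescartes.WallBubbling

open Finset Filter Topology
open Bubbling (expSum hasDerivAt_expSum)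

/-! ## §1 Local signs of an exponential sum at a simple and at a double zero -/

/-- `expSum` is continuous. [folklore] -/
theorem continuous_expSum {ι : Type*} [Fintype ι] (a x : ι → ℝ) : Continuous (expSum a x) :=
  continuous_iff_continuousAt.2 fun t => (hasDerivAt_expSum a x t).continuousAt

/-- `deriv (expSum a x) = expSum (a · x) x`. [folklore] -/
theorem deriv_expSum_eq {ι : Type*} [Fintype ι] (a x : ι → ℝ) :
    deriv (expSum a x) = expSum (fun i => a i * x i) x :=
  funext fun t => (hasDerivAt_expSum a x t).deriv

/-- **Sign of an exponential sum next to a SIMPLE zero**: if `f(z) = 0` and `f′(z) ≠ 0` then, on some punctured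
neighbourhood, `f′(z)·f > 0` to the right of `z` and `f′(z)·f < 0` to the left. [folklore] -/
theorem expSum_sign_near_simple {ι : Type*} [Fintype ι] (a x : ι → ℝ) (z : ℝ) (hz : expSum a x z = 0)
    (hd : expSum (fun i => a i * x i) x z ≠ 0) :
    ∃ η > 0, (∀ t, z < t → t < z + η → 0 < expSum (fun i => a i * x i) x z * expSum a x t) ∧
      (∀ t, z - η < t → t < z → expSum (fun i => a i * x i) x z * expSum a x t < 0) := by
  set f := expSum a x with hf
  set f' := expSum (fun i => a i * x i) x with hf'
  -- `f'` keeps the sign of `f' z` on a neighbourhood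
  have hcont : Continuous f' := continuous_expSum _ _
  have hsign : ∀ᶠ t in 𝓝 z, 0 < f' z * f' t := by
    have h2 : 0 < f' z * f' z := mul_self_pos.2 hd
    exact (hcont.const_mul (f' z)).continuousAt.eventually (p := fun y => 0 < y) (isOpen_Ioi.mem_nhds h2)
  obtain ⟨η, hη, hball⟩ := Metric.eventually_nhds_iff.1 hsign
  refine ⟨η, hη, ?_, ?_⟩
  · intro t hzt htη
    -- `g := f' z • f` is strictly increasing on `[z, z + η)`
    have hmono : StrictMonoOn (fun s => f' z * f s) (Set.Icc z t) := by
      refine strictMonoOn_of_deriv_pos (convex_Icc z t) ?_ ?_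
      · exact ((continuous_expSum a x).const_mul _).continuousOn
      · intro s hs
        rw [interior_Icc] at hs
        have hderiv : deriv (fun s => f' z * f s) s = f' z * f' s := by
          rw [deriv_const_mul _ (hasDerivAt_expSum a x s).differentiableAt, (hasDerivAt_expSum a x s).deriv]
        rw [hderiv]
        refine hball ?_
        rw [Real.dist_eq, abs_lt]; constructor <;> linarith [hs.1, hs.2]
    have := hmono ⟨le_refl z, hzt.le⟩ ⟨hzt.le, le_refl t⟩ hzt
    simp only [hz, mul_zero] at this
    exact this
  · intro t hηt htz
    have hmono : StrictMonoOn (fun s => f' z * f s) (Set.Icc t z) := by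
      refine strictMonoOn_of_deriv_pos (convex_Icc t z) ?_ ?_
      · exact ((continuous_expSum a x).const_mul _).continuousOn
      · intro s hs
        rw [interior_Icc] at hs
        have hderiv : deriv (fun s => f' z * f s) s = f' z * f' s := by
          rw [deriv_const_mul _ (hasDerivAt_expSum a x s).differentiableAt, (hasDerivAt_expSum a x s).deriv]
        rw [hderiv]
        refine hball ?_
        rw [Real.dist_eq, abs_lt]; constructor <;> linarith [hs.1, hs.2]
    have := hmono ⟨le_refl t, htz.le⟩ ⟨htz.le, le_refl z⟩ htz
    simp only [hz, mul_zero] at this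
    exact this

/-- **Sign of an exponential sum next to a DOUBLE zero**: if `f(z) = f′(z) = 0` and `f″(z) ≠ 0` then `f″(z)·f > 0` on a
punctured neighbourhood of `z` (apply the simple-zero lemma to `f′` and integrate the sign). [folklore] -/
theorem expSum_sign_near_double {ι : Type*} [Fintype ι] (a x : ι → ℝ) (z : ℝ) (hz : expSum a x z = 0)
    (hd1 : expSum (fun i => a i * x i) x z = 0) (hd2 : expSum (fun i => a i * x i * x i) x z ≠ 0) :
    ∃ η > 0, ∀ t, z - η < t → t < z + η → t ≠ z → 0 < expSum (fun i => a i * x i * x i) x z * expSum a x t := by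
  set f := expSum a x with hf
  set f' := expSum (fun i => a i * x i) x with hf'
  set f'' := expSum (fun i => a i * x i * x i) x with hf''
  obtain ⟨η, hη, hright, hleft⟩ := expSum_sign_near_simple (fun i => a i * x i) x z hd1 hd2
  refine ⟨η, hη, fun t h1 h2 hne => ?_⟩
  rcases lt_or_gt_of_ne hne with htz | hzt
  · -- left of `z`: `f'' z • f' < 0` on `(t, z)`, so `f'' z • f` decreases from `t` to `z`
    have hanti : StrictAntiOn (fun s => f'' z * f s) (Set.Icc t z) := by
      refine strictAntiOn_of_deriv_neg (convex_Icc t z) ?_ ?_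
      · exact ((continuous_expSum a x).const_mul _).continuousOn
      · intro s hs
        rw [interior_Icc] at hs
        have hderiv : deriv (fun s => f'' z * f s) s = f'' z * f' s := by
          rw [deriv_const_mul _ (hasDerivAt_expSum a x s).differentiableAt, (hasDerivAt_expSum a x s).deriv]
        rw [hderiv]
        exact hleft s (by linarith [hs.1]) hs.2
    have := hanti ⟨le_refl t, htz.le⟩ ⟨htz.le, le_refl z⟩ htz
    simp only [hz, mul_zero] at this
    exact this
  · have hmono : StrictMonoOn (fun s => f'' z * f s) (Set.Icc z t) := by
      refine strictMonoOn_of_deriv_pos (convex_Icc z t) ?_ ?_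
      · exact ((continuous_expSum a x).const_mul _).continuousOn
      · intro s hs
        rw [interior_Icc] at hs
        have hderiv : deriv (fun s => f'' z * f s) s = f'' z * f' s := by
          rw [deriv_const_mul _ (hasDerivAt_expSum a x s).differentiableAt, (hasDerivAt_expSum a x s).deriv]
        rw [hderiv]
        exact hright s hs.1 (by linarith [hs.2])
    have := hmono ⟨le_refl z, hzt.le⟩ ⟨hzt.le, le_refl t⟩ hzt
    simp only [hz, mul_zero] at this
    exact this

/-- **Sign propagation across a zero-free interval**: a continuous `f` without zeros on `[s, t]` has `0 < f s · f t`. [folklore] -/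
theorem mul_pos_of_no_zero {f : ℝ → ℝ} (hf : Continuous f) {s t : ℝ} (hst : s ≤ t)
    (hno : ∀ u, s ≤ u → u ≤ t → f u ≠ 0) : 0 < f s * f t := by
  rcases eq_or_lt_of_le hst with rfl | hlt
  · exact mul_self_pos.2 (hno s le_rfl le_rfl)
  by_contra hle
  rcases lt_or_eq_of_le (not_lt.1 hle) with hneg | hzero
  · obtain ⟨u, hu, hfu⟩ := Census.RealExp.exists_zero_of_mul_neg hlt hf.continuousOn hneg
    exact hno u hu.1.le hu.2.le hfu
  · rcases mul_eq_zero.1 hzero with h | h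
    · exact hno s le_rfl hst h
    · exact hno t hst le_rfl h

end Summit.ValiantsHypothesis.ValiantsHypothesis.Theorems.LacunarySymmetroidMatrixDescartes.WallBubbling
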